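import Mathlib
import HarnessLib
import Literature.Probability.LatticeModels.ProductMeasureTools
import Summits.Ventures.LatticeQCDFlow.Exactness.SphereLuscherSeriesCoefficientCount
import Summits.Ventures.LatticeQCDFlow.Exactness.LatticeCoordAvg

/-!
# The variance of a sum of local functionals of an i.i.d. lattice field is extensive: `Var(Σ_n F_n) ≤ |Λ|·(Δ+1)^{2r}·max_n Var(F_n)`

HONEST FRAMING: exact (Metropolis-corrected) sampling algorithms for lattice gauge theory;
figures of merit are autocorrelation/cost numbers at stated couplings and volumes; no
continuum-physics claim.

Venture `LatticeQCDFlow` (cell pub-lqcd), topic `Exactness`; FANOUT row 7 (`s0-cpn-null`: the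
S0-D1 rung — 2D CP⁹, Lüscher's LO trivializing map inside HMC, Engel–Schaefer 2011).  NEW WORK of
the cell over Mathlib, the tree's `Exactness/SphereLuscherSeriesLocality.lean` (`nball N r n`, the
radius-`r` ball of a neighbourhood structure), `Exactness/SphereLuscherSeriesCoefficientCount.lean`
(`ncard_nball_le`: `|nball N r n| ≤ (Δ+1)^r` under a coordination bound `Δ`),
`Exactness/LatticeCoordAvg.lean` (`integrable_pi_of_continuous`) and the Literature support lemma
`Literature.Probability.LatticeModels.integral_mul_eq_of_dependsOn_disjoint` ([folklore]: functions
of disjoint coordinate blocks of a product probability measure are uncorrelated — REUSED, not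
restated); nothing is cited as a fact.  Printed counterpart, NAMED ONLY: M. Lüscher, Commun. Math.
Phys. 293 (2010) 899, §4.4–§4.5 (each order of the flow action is a sum over sites of local terms
with bounded footprint); this file is the measure-theoretic half of the statement that such sums
have EXTENSIVE fluctuations under the product measure — the sequel
`Exactness/SphereLuscherSeriesExtensive.lean` applies it to the Engel–Schaefer / CP(N−1) series with
the volume-independent local bounds of `Exactness/SphereLuscherLocalTermBounds.lean`.

## Setting

`ι` a finite index set (the lattice `Λ`); `X` a compact metric space with its Borel σ-algebra and a
probability measure `μ` (the sequel: the unit sphere with `uniformSphere volume`); `π = ⊗_ι μ` on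
`ι → X`; `N : ι → Set ι` a SYMMETRIC neighbourhood structure (`m ∈ N n ↔ n ∈ N m`) with at most `Δ`
neighbours per site; `F_n : (ι → X) → ℝ` continuous, depending only on the coordinates in
`nball N r n`; `Var(F) = ∫(F − ∫F dπ)² dπ`.

## Content

* §1 **`mem_nball_comm`** — for a symmetric structure the balls are symmetric:
  `m ∈ nball N r n → n ∈ nball N r m`; **`ncard_overlap_le`** — the number of sites `n'` whose
  `r`-ball MEETS the `r`-ball of `n` is `≤ (Δ+1)^r·(Δ+1)^r`, uniformly in `|ι|`.
* §2 COVARIANCE ALGEBRA under `π` (continuous integrands on the compact product):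
  `dependsOn_sub_const`, **`integral_centered_mul_eq_zero_of_disjoint`** (functions of DISJOINT
  coordinate blocks have zero covariance — the Literature block-independence lemma),
  `integral_centered_mul_le` (`∫(f−f̄)(g−ḡ) ≤ (Var f + Var g)/2`), `variance_sub_const`
  (`Var(f − d) = Var f`), **`variance_sum_eq_sum_cov`**
  (`Var(Σ_{a∈s} F_a) = Σ_a Σ_b ∫(F_a − F̄_a)(F_b − F̄_b)`).
* §3 **`variance_sum_le_of_local`** — THE EXTENSIVITY BOUND: if every `F_n` depends only on
  `nball N r n` (symmetric `N`, coordination `≤ Δ`) and `Var(F_n) ≤ b` for all `n`, then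
  `Var(Σ_n F_n) ≤ |ι|·((Δ+1)^r·(Δ+1)^r)·b` — LINEAR IN THE VOLUME with a constant governed by the
  footprint radius and the coordination number only (finite-range dependence: only the
  `≤ (Δ+1)^{2r}` overlapping pairs per site contribute, each by at most `b`).

NOT CLAIMED: lower bounds (no positivity of the variance density is asserted); sharper overlap
counts (on `ℤ²` balls grow quadratically); anything about non-product measures; anything
quantitative about the rung.
-/

noncomputable section

namespace Summit.Ventures.LatticeQCDFlow.Exactness

open Function Set MeasureTheory

/-! ## §1 Symmetric balls and the overlap count -/

section Balls

variable {Λ : Type*} {N : Λ → Set Λ}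

/-- **Balls of a symmetric neighbourhood structure are symmetric**: `m ∈ nball N r n → n ∈ nball N r m`. -/
theorem mem_nball_comm (hN : ∀ m n, m ∈ N n → n ∈ N m) :
    ∀ (r : ℕ) {m n : Λ}, m ∈ nball N r n → n ∈ nball N r m
  | 0, m, n, h => by
      rw [mem_nball_zero] at h ⊢
      exact h.symm
  | r + 1, m, n, h => by
      rw [nball_succ, mem_union] at h
      rcases h with h | h
      · exact nball_subset_succ r m (mem_nball_comm hN r h)
      · obtain ⟨m', hm', hmm'⟩ := mem_iUnion₂.1 h
        have h1 : m' ∈ nball N 1 m := subset_nball_one m (hN m m' hmm')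
        have h2 := nball_subset_nball_add h1 r (mem_nball_comm hN r hm')
        rwa [add_comm] at h2

variable [Fintype Λ]

/-- **The overlap count**: for a symmetric structure with at most `Δ` neighbours per site, the sites
`n'` whose radius-`r` ball meets the radius-`r` ball of `n` number at most `(Δ+1)^r·(Δ+1)^r` —
independently of `|Λ|`. -/
theorem ncard_overlap_le (hN : ∀ m n, m ∈ N n → n ∈ N m) {Δ : ℕ} (hΔ : ∀ m, (N m).ncard ≤ Δ)
    (r : ℕ) (n : Λ) :
    {n' | (nball N r n ∩ nball N r n').Nonempty}.ncard ≤ (Δ + 1) ^ r * (Δ + 1) ^ r := by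
  classical
  set Bn : Finset Λ := (toFinite (nball N r n)).toFinset with hBn
  set Bm : Λ → Finset Λ := fun m => (toFinite (nball N r m)).toFinset with hBm
  have hsub : {n' | (nball N r n ∩ nball N r n').Nonempty} ⊆ ↑(Bn.biUnion Bm) := by
    rintro n' ⟨m, hmn, hmn'⟩
    simp only [Finset.coe_biUnion, Finset.mem_coe, mem_iUnion, hBn, hBm, Finite.mem_toFinset]
    exact ⟨m, hmn, mem_nball_comm hN r hmn'⟩
  have hcard : ∀ m, (Bm m).card ≤ (Δ + 1) ^ r := fun m => by
    rw [hBm, ← ncard_eq_toFinset_card _ (toFinite _)]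
    exact ncard_nball_le hΔ m r
  calc {n' | (nball N r n ∩ nball N r n').Nonempty}.ncard
      ≤ (↑(Bn.biUnion Bm) : Set Λ).ncard := ncard_le_ncard hsub (toFinite _)
    _ = (Bn.biUnion Bm).card := ncard_coe_finset _
    _ ≤ ∑ m ∈ Bn, (Bm m).card := Finset.card_biUnion_le
    _ ≤ ∑ _m ∈ Bn, (Δ + 1) ^ r := Finset.sum_le_sum fun m _ => hcard m
    _ = Bn.card * (Δ + 1) ^ r := by rw [Finset.sum_const, smul_eq_mul]
    _ ≤ (Δ + 1) ^ r * (Δ + 1) ^ r := Nat.mul_le_mul_right _ (hcard n)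

end Balls

/-! ## §2 Covariance algebra under a product probability measure -/

section Covariance

variable {ι : Type*} [Fintype ι] {X : Type*} [MeasurableSpace X] [MetricSpace X]
  [CompactSpace X] [BorelSpace X] (μ : Measure X) [IsProbabilityMeasure μ]

omit [Fintype ι] [MeasurableSpace X] [MetricSpace X] [CompactSpace X] [BorelSpace X] in
/-- Shifting by a constant does not change the dependence set. -/
theorem dependsOn_sub_const {S : Set ι} {f : (ι → X) → ℝ} (hf : DependsOn f S) (c : ℝ) :
    DependsOn (fun ω => f ω - c) S := fun _ _ h => by
  show f _ - c = f _ - c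
  rw [hf h]

/-- **Functions of disjoint coordinate blocks have zero covariance** under the product probability
measure: `∫ (f − ∫f)(g − ∫g) dπ = 0` for continuous `f`, `g` depending only on the coordinates in
disjoint sets `S`, `T` (the Literature's block-independence lemma, centred). -/
theorem integral_centered_mul_eq_zero_of_disjoint {S T : Set ι} (hST : Disjoint S T)
    {f g : (ι → X) → ℝ} (hf : Continuous f) (hg : Continuous g) (hfS : DependsOn f S)
    (hgT : DependsOn g T) :
    ∫ ω, (f ω - ∫ ω', f ω' ∂Measure.pi (fun _ : ι => μ)) *
        (g ω - ∫ ω', g ω' ∂Measure.pi (fun _ : ι => μ)) ∂Measure.pi (fun _ : ι => μ) = 0 := by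
  classical
  set mf : ℝ := ∫ ω', f ω' ∂Measure.pi (fun _ : ι => μ) with hmf
  set mg : ℝ := ∫ ω', g ω' ∂Measure.pi (fun _ : ι => μ) with hmg
  have hfm : Measurable fun ω => f ω - mf := (hf.sub continuous_const).measurable
  have hgm : Measurable fun ω => g ω - mg := (hg.sub continuous_const).measurable
  have key : ∫ ω, (f ω - mf) * (g ω - mg) ∂Measure.pi (fun _ : ι => μ) =
      (∫ ω, (f ω - mf) ∂Measure.pi (fun _ : ι => μ)) * ∫ ω, (g ω - mg) ∂Measure.pi (fun _ : ι => μ) := by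
    rw [← Measure.infinitePi_eq_pi]
    exact Literature.Probability.LatticeModels.integral_mul_eq_of_dependsOn_disjoint (fun _ : ι => μ)
      (S := S.toFinset) (T := T.toFinset) (Set.disjoint_toFinset.2 hST) hfm hgm
      (by simpa using dependsOn_sub_const hfS mf) (by simpa using dependsOn_sub_const hgT mg)
  have h0 : ∫ ω, (f ω - mf) ∂Measure.pi (fun _ : ι => μ) = 0 := by
    rw [integral_sub (integrable_pi_of_continuous μ hf) (integrable_const mf), integral_const,
      smul_eq_mul, Measure.real, measure_univ, ENNReal.toReal_one, one_mul, hmf, sub_self]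
  rw [key, h0, zero_mul]

/-- `∫ (f − ∫f)(g − ∫g) dπ ≤ (Var f + Var g)/2` (pointwise `2xy ≤ x² + y²`). -/
theorem integral_centered_mul_le {f g : (ι → X) → ℝ} (hf : Continuous f) (hg : Continuous g) :
    ∫ ω, (f ω - ∫ ω', f ω' ∂Measure.pi (fun _ : ι => μ)) *
        (g ω - ∫ ω', g ω' ∂Measure.pi (fun _ : ι => μ)) ∂Measure.pi (fun _ : ι => μ) ≤
      (∫ ω, (f ω - ∫ ω', f ω' ∂Measure.pi (fun _ : ι => μ)) ^ 2 ∂Measure.pi (fun _ : ι => μ) +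
        ∫ ω, (g ω - ∫ ω', g ω' ∂Measure.pi (fun _ : ι => μ)) ^ 2 ∂Measure.pi (fun _ : ι => μ)) / 2 := by
  set mf : ℝ := ∫ ω', f ω' ∂Measure.pi (fun _ : ι => μ) with hmf
  set mg : ℝ := ∫ ω', g ω' ∂Measure.pi (fun _ : ι => μ) with hmg
  have hiF : Integrable (fun ω => (f ω - mf) ^ 2) (Measure.pi fun _ : ι => μ) :=
    integrable_pi_of_continuous μ ((hf.sub continuous_const).pow 2)
  have hiG : Integrable (fun ω => (g ω - mg) ^ 2) (Measure.pi fun _ : ι => μ) :=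
    integrable_pi_of_continuous μ ((hg.sub continuous_const).pow 2)
  have hiP : Integrable (fun ω => (f ω - mf) * (g ω - mg)) (Measure.pi fun _ : ι => μ) :=
    integrable_pi_of_continuous μ ((hf.sub continuous_const).mul (hg.sub continuous_const))
  rw [le_div_iff₀ (by norm_num : (0 : ℝ) < 2), ← integral_add hiF hiG, mul_comm, ← integral_const_mul]
  refine integral_mono (hiP.const_mul _) (hiF.add hiG) fun ω => ?_
  nlinarith [sq_nonneg ((f ω - mf) - (g ω - mg))]

/-- **The variance is shift-invariant**: `Var(f − d) = Var(f)` (continuous `f`, constant `d`). -/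
theorem variance_sub_const {f : (ι → X) → ℝ} (hf : Continuous f) (d : ℝ) :
    ∫ ω, ((f ω - d) - ∫ ω', (f ω' - d) ∂Measure.pi (fun _ : ι => μ)) ^ 2 ∂Measure.pi (fun _ : ι => μ) =
      ∫ ω, (f ω - ∫ ω', f ω' ∂Measure.pi (fun _ : ι => μ)) ^ 2 ∂Measure.pi (fun _ : ι => μ) := by
  have h : ∫ ω', (f ω' - d) ∂Measure.pi (fun _ : ι => μ) =
      (∫ ω', f ω' ∂Measure.pi (fun _ : ι => μ)) - d := by
    rw [integral_sub (integrable_pi_of_continuous μ hf) (integrable_const d), integral_const,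
      smul_eq_mul, Measure.real, measure_univ, ENNReal.toReal_one, one_mul]
  rw [h]
  exact integral_congr_ae (ae_of_all _ fun ω => by ring)

/-- **The variance of a finite sum is the sum of the covariances**:
`Var(Σ_{a∈s} F_a) = Σ_{a∈s} Σ_{b∈s} ∫ (F_a − ∫F_a)(F_b − ∫F_b) dπ` (continuous `F_a`). -/
theorem variance_sum_eq_sum_cov {α : Type*} (s : Finset α) {F : α → (ι → X) → ℝ}
    (hF : ∀ a ∈ s, Continuous (F a)) :
    ∫ ω, ((∑ a ∈ s, F a ω) - ∫ ω', ∑ a ∈ s, F a ω' ∂Measure.pi (fun _ : ι => μ)) ^ 2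
        ∂Measure.pi (fun _ : ι => μ) =
      ∑ a ∈ s, ∑ b ∈ s, ∫ ω, (F a ω - ∫ ω', F a ω' ∂Measure.pi (fun _ : ι => μ)) *
        (F b ω - ∫ ω', F b ω' ∂Measure.pi (fun _ : ι => μ)) ∂Measure.pi (fun _ : ι => μ) := by
  have hmean : ∫ ω', ∑ a ∈ s, F a ω' ∂Measure.pi (fun _ : ι => μ) =
      ∑ a ∈ s, ∫ ω', F a ω' ∂Measure.pi (fun _ : ι => μ) :=
    integral_finsetSum s fun a ha => integrable_pi_of_continuous μ (hF a ha)
  have hpt : ∀ ω : ι → X, ((∑ a ∈ s, F a ω) - ∫ ω', ∑ a ∈ s, F a ω' ∂Measure.pi (fun _ : ι => μ)) ^ 2 =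
      ∑ a ∈ s, ∑ b ∈ s, (F a ω - ∫ ω', F a ω' ∂Measure.pi (fun _ : ι => μ)) *
        (F b ω - ∫ ω', F b ω' ∂Measure.pi (fun _ : ι => μ)) := fun ω => by
    rw [hmean, ← Finset.sum_sub_distrib, sq, Finset.sum_mul_sum]
  simp_rw [hpt]
  have hI2 : ∀ a ∈ s, ∀ b ∈ s, Integrable (fun ω : ι → X =>
      (F a ω - ∫ ω', F a ω' ∂Measure.pi (fun _ : ι => μ)) *
        (F b ω - ∫ ω', F b ω' ∂Measure.pi (fun _ : ι => μ))) (Measure.pi fun _ : ι => μ) :=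
    fun a ha b hb => integrable_pi_of_continuous μ (((hF a ha).sub continuous_const).mul
      ((hF b hb).sub continuous_const))
  have hI1 : ∀ a ∈ s, Integrable (fun ω : ι → X => ∑ b ∈ s,
      (F a ω - ∫ ω', F a ω' ∂Measure.pi (fun _ : ι => μ)) *
        (F b ω - ∫ ω', F b ω' ∂Measure.pi (fun _ : ι => μ))) (Measure.pi fun _ : ι => μ) :=
    fun a ha => integrable_finsetSum s (hI2 a ha)
  rw [integral_finsetSum s hI1]
  exact Finset.sum_congr rfl fun a ha => integral_finsetSum s (hI2 a ha)

end Covariance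

/-! ## §3 Extensivity of the variance of a sum of local functionals -/

section Extensive

variable {ι : Type*} [Fintype ι] {X : Type*} [MeasurableSpace X] [MetricSpace X]
  [CompactSpace X] [BorelSpace X] (μ : Measure X) [IsProbabilityMeasure μ]

/-- **THE VARIANCE OF A SUM OF LOCAL FUNCTIONALS IS EXTENSIVE.**  Let `N` be a symmetric
neighbourhood structure on the finite lattice `ι` with at most `Δ` neighbours per site, and let
`F_n` (`n ∈ ι`) be continuous functionals of the i.i.d. field `ω ∼ ⊗_ι μ`, `F_n` depending only on
the coordinates in `nball N r n`, with `Var(F_n) ≤ b` for every `n`.  Then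
`Var(Σ_n F_n) ≤ |ι| · ((Δ+1)^r·(Δ+1)^r) · b` — linear in the volume, the constant depending on the
footprint radius and the coordination number only. -/
theorem variance_sum_le_of_local {N : ι → Set ι} (hN : ∀ m n, m ∈ N n → n ∈ N m) {Δ : ℕ}
    (hΔ : ∀ m, (N m).ncard ≤ Δ) (r : ℕ) {F : ι → (ι → X) → ℝ} (hFc : ∀ n, Continuous (F n))
    (hFdep : ∀ n, DependsOn (F n) (nball N r n)) {b : ℝ}
    (hb : ∀ n, ∫ ω, (F n ω - ∫ ω', F n ω' ∂Measure.pi (fun _ : ι => μ)) ^ 2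
      ∂Measure.pi (fun _ : ι => μ) ≤ b) :
    ∫ ω, ((∑ n, F n ω) - ∫ ω', ∑ n, F n ω' ∂Measure.pi (fun _ : ι => μ)) ^ 2
        ∂Measure.pi (fun _ : ι => μ) ≤
      Fintype.card ι * (((Δ + 1) ^ r * (Δ + 1) ^ r : ℕ) : ℝ) * b := by
  classical
  rw [variance_sum_eq_sum_cov μ Finset.univ fun n _ => hFc n]
  -- abbreviation for the covariances
  set C : ι → ι → ℝ := fun a c => ∫ ω, (F a ω - ∫ ω', F a ω' ∂Measure.pi (fun _ : ι => μ)) *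
    (F c ω - ∫ ω', F c ω' ∂Measure.pi (fun _ : ι => μ)) ∂Measure.pi (fun _ : ι => μ) with hC
  -- each row of the covariance matrix: only the overlapping partners contribute, each by `≤ b`
  have hrow : ∀ n, ∑ n', C n n' ≤ (((Δ + 1) ^ r * (Δ + 1) ^ r : ℕ) : ℝ) * b := fun n => by
    have hb0 : 0 ≤ b := (integral_nonneg fun ω => sq_nonneg _).trans (hb n)
    set O : Finset ι := Finset.univ.filter fun n' => (nball N r n ∩ nball N r n').Nonempty with hO
    have hzero : ∀ n' ∉ O, C n n' = 0 := fun n' hn' => by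
      have hdis : Disjoint (nball N r n) (nball N r n') := by
        rw [Set.disjoint_iff_inter_eq_empty, ← Set.not_nonempty_iff_eq_empty]
        exact fun h => hn' (Finset.mem_filter.2 ⟨Finset.mem_univ _, h⟩)
      exact integral_centered_mul_eq_zero_of_disjoint μ hdis (hFc n) (hFc n') (hFdep n) (hFdep n')
    have hle : ∀ n', C n n' ≤ b := fun n' =>
      (integral_centered_mul_le μ (hFc n) (hFc n')).trans (by linarith [hb n, hb n'])
    have hOcard : (O.card : ℝ) ≤ (((Δ + 1) ^ r * (Δ + 1) ^ r : ℕ) : ℝ) := by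
      have h1 : O.card ≤ (Δ + 1) ^ r * (Δ + 1) ^ r := by
        have e : O.card = {n' | (nball N r n ∩ nball N r n').Nonempty}.ncard := by
          rw [← ncard_coe_finset O]
          congr 1
          ext n'
          simp [hO]
        rw [e]
        exact ncard_overlap_le hN hΔ r n
      exact_mod_cast h1
    calc ∑ n', C n n' = ∑ n' ∈ O, C n n' :=
          (Finset.sum_subset (Finset.subset_univ O) fun n' _ hn' => hzero n' hn').symm
      _ ≤ ∑ _n' ∈ O, b := Finset.sum_le_sum fun n' _ => hle n'
      _ = O.card * b := by rw [Finset.sum_const, nsmul_eq_mul]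
      _ ≤ _ := mul_le_mul_of_nonneg_right hOcard hb0
  calc ∑ n, ∑ n', C n n' ≤ ∑ _n : ι, (((Δ + 1) ^ r * (Δ + 1) ^ r : ℕ) : ℝ) * b :=
        Finset.sum_le_sum fun n _ => hrow n
    _ = Fintype.card ι * (((Δ + 1) ^ r * (Δ + 1) ^ r : ℕ) : ℝ) * b := by
        rw [Finset.sum_const, Finset.card_univ, nsmul_eq_mul]; ring

end Extensive

end Summit.Ventures.LatticeQCDFlow.Exactness

end
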